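import Literature.NumberTheory.NumberFields.CubicFieldExplicit
import Literature.NumberTheory.NumberFields.IntegralBasisCriterion
import Mathlib.NumberTheory.NumberField.Discriminant.Basic
import Mathlib.NumberTheory.NumberField.ClassNumber
import Mathlib.NumberTheory.NumberField.Units.DirichletTheorem
import Mathlib.Analysis.Real.Pi.Bounds
import HarnessLib

/-!
# BirchSwinnertonDyer — rank ≥ 2 observatory: signature, unit rank and small-discriminant class number of a cubic field

HONEST FRAMING: per-curve certified theorems and census instruments; no claim on BSD in rank ≥ 2.

Generic file of the KERNEL-2DESC instrument (design `b2b-bsdr2-cert-3/KERNEL-2DESC.md` §4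
A5(i)–(ii), §8 S3): for `K = ℚ(θ)`, `θ` a root of the irreducible `F = X³ + AX² + BX + C`,

* `Δ(F) = (index)²·d_K` (`disc_eq_indexDet_sq_mul_discr`), hence `sign d_K = sign Δ(F)` and
  `|d_K| ≤ |Δ(F)|`;
* the SIGNATURE from the sign of `Δ(F)` (Brill: `sign d_K = (−1)^{r₂}`, `NumberField.sign_discr`):
  `Δ(F) < 0 ⇒ (r₁, r₂) = (1, 1)`, unit rank `1`; `Δ(F) > 0 ⇒ (r₁, r₂) = (3, 0)`, unit rank `2`;
* CLASS NUMBER ONE from the Minkowski bound when it is `< 2`: `|Δ(F)| ≤ 49` (any cubic field) or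
  `0 < Δ(F) ≤ 80` (totally real) `⇒ 𝓞 K` is a PID (`NumberField.RingOfIntegers.
  isPrincipalIdealRing_of_abs_discr_lt`);
* the concrete model `CubicField A B C = ℚ[X]/(F)` (`AdjoinRoot`), a number field of degree `3`
  with the root `CubicField.root`, so that per-curve rank theorems can be stated over `ℚ` alone.

Sorry-free; axioms `propext`, `Classical.choice`, `Quot.sound`. Mathematics: Marcus, *Number
Fields* (2nd ed.), Ch. 2 (discriminant and index), Ch. 5 (Minkowski bound, Thm 35 ff.);
Dirichlet's unit theorem (Mathlib).
-/

-- single-conjunct summit: `Summit.BirchSwinnertonDyer.BirchSwinnertonDyer.…` repeats the name by design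
set_option linter.dupNamespace false

noncomputable section

open scoped Classical NumberField Real

open Literature.NumberTheory.NumberFields Polynomial Module NumberField NumberField.InfinitePlace

namespace Summit.BirchSwinnertonDyer.BirchSwinnertonDyer.Rank2Observatory.TwoDescCubic

section Signature

variable {K : Type*} [Field K] [NumberField K] {A B C : ℤ} {θ : K}

/-- **`Δ(F) = (index)²·d_K`** for `K = ℚ(θ)`, `F(θ) = 0`, `F` irreducible cubic: the polynomial
discriminant is the field discriminant times the square of the index `[𝓞 K : ℤ[θ]]`.
[cite: Marcus2018, Ch. 2, Ex. 27] -/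
theorem disc_eq_indexDet_sq_mul_discr (hirr : Irreducible (MonicCubic.polyQ A B C))
    (hθ : aeval θ (MonicCubic.poly A B C) = 0) (h3 : finrank ℚ K = 3) :
    MonicCubic.disc A B C = indexDet (MonicCubic.pb hirr hθ h3)
      (MonicCubic.isIntegral_pb_gen hirr hθ h3) ^ 2 * NumberField.discr K := by
  have h := discr_powerBasis_eq_indexDet_sq_mul_discr (MonicCubic.pb hirr hθ h3)
    (MonicCubic.isIntegral_pb_gen hirr hθ h3)
  rw [MonicCubic.discr_pb hirr hθ h3] at h
  exact_mod_cast h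

/-- `|d_K| ≤ |Δ(F)|`. [cite: Marcus2018, Ch. 2, Ex. 27] -/
theorem abs_discr_le_abs_disc (hirr : Irreducible (MonicCubic.polyQ A B C))
    (hθ : aeval θ (MonicCubic.poly A B C) = 0) (h3 : finrank ℚ K = 3) :
    |NumberField.discr K| ≤ |MonicCubic.disc A B C| := by
  have hne := indexDet_ne_zero (MonicCubic.pb hirr hθ h3) (MonicCubic.isIntegral_pb_gen hirr hθ h3)
  rw [disc_eq_indexDet_sq_mul_discr hirr hθ h3, abs_mul, abs_pow]
  have h1 : 1 ≤ |indexDet (MonicCubic.pb hirr hθ h3) (MonicCubic.isIntegral_pb_gen hirr hθ h3)| ^ 2 :=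
    one_le_pow₀ (Int.one_le_abs hne)
  calc |NumberField.discr K| = 1 * |NumberField.discr K| := (one_mul _).symm
    _ ≤ _ := mul_le_mul_of_nonneg_right h1 (abs_nonneg _)

/-- `d_K < 0 ↔ Δ(F) < 0`. [cite: Marcus2018, Ch. 2, Ex. 27] -/
theorem discr_neg_iff_disc_neg (hirr : Irreducible (MonicCubic.polyQ A B C))
    (hθ : aeval θ (MonicCubic.poly A B C) = 0) (h3 : finrank ℚ K = 3) :
    NumberField.discr K < 0 ↔ MonicCubic.disc A B C < 0 := by
  have hne := indexDet_ne_zero (MonicCubic.pb hirr hθ h3) (MonicCubic.isIntegral_pb_gen hirr hθ h3)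
  have hpos : 0 < indexDet (MonicCubic.pb hirr hθ h3) (MonicCubic.isIntegral_pb_gen hirr hθ h3) ^ 2 :=
    by positivity
  rw [disc_eq_indexDet_sq_mul_discr hirr hθ h3, mul_neg_iff]
  constructor
  · intro h; exact Or.inl ⟨hpos, h⟩
  · rintro (⟨-, h⟩ | ⟨h, -⟩)
    · exact h
    · exact absurd h (not_lt.mpr hpos.le)

/-- A cubic field has `r₂ ≤ 1` (`r₁ + 2r₂ = 3`). [folklore] -/
theorem nrComplexPlaces_le_one (h3 : finrank ℚ K = 3) : nrComplexPlaces K ≤ 1 := by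
  have h := card_add_two_mul_card_eq_rank K
  omega

/-- **Complex cubic**: `Δ(F) < 0 ⇒ r₂ = 1`. [cite: Marcus2018, Ch. 2] -/
theorem nrComplexPlaces_eq_one_of_disc_neg (hirr : Irreducible (MonicCubic.polyQ A B C))
    (hθ : aeval θ (MonicCubic.poly A B C) = 0) (h3 : finrank ℚ K = 3)
    (hneg : MonicCubic.disc A B C < 0) : nrComplexPlaces K = 1 := by
  have hd : NumberField.discr K < 0 := (discr_neg_iff_disc_neg hirr hθ h3).mpr hneg
  have hs := NumberField.sign_discr (K := K)
  rw [Int.sign_eq_neg_one_of_neg hd] at hs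
  have hodd : Odd (nrComplexPlaces K) := by
    by_contra heven
    rw [Nat.not_odd_iff_even] at heven
    rw [heven.neg_one_pow] at hs
    norm_num at hs
  have hle := nrComplexPlaces_le_one h3
  obtain ⟨k, hk⟩ := hodd
  omega

/-- **Complex cubic**: `Δ(F) < 0 ⇒ r₁ = 1`. [cite: Marcus2018, Ch. 2] -/
theorem nrRealPlaces_eq_one_of_disc_neg (hirr : Irreducible (MonicCubic.polyQ A B C))
    (hθ : aeval θ (MonicCubic.poly A B C) = 0) (h3 : finrank ℚ K = 3)
    (hneg : MonicCubic.disc A B C < 0) : nrRealPlaces K = 1 := by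
  have h := card_add_two_mul_card_eq_rank K
  rw [nrComplexPlaces_eq_one_of_disc_neg hirr hθ h3 hneg, h3] at h
  omega

/-- **Complex cubic: unit rank one** (Dirichlet: `r₁ + r₂ − 1 = 1`). [cite: Marcus2018, Ch. 5] -/
theorem units_rank_eq_one_of_disc_neg (hirr : Irreducible (MonicCubic.polyQ A B C))
    (hθ : aeval θ (MonicCubic.poly A B C) = 0) (h3 : finrank ℚ K = 3)
    (hneg : MonicCubic.disc A B C < 0) : NumberField.Units.rank K = 1 := by
  rw [NumberField.Units.rank, card_eq_nrRealPlaces_add_nrComplexPlaces,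
    nrRealPlaces_eq_one_of_disc_neg hirr hθ h3 hneg, nrComplexPlaces_eq_one_of_disc_neg hirr hθ h3 hneg]

/-- **Totally real cubic**: `Δ(F) > 0 ⇒ r₂ = 0`. [cite: Marcus2018, Ch. 2] -/
theorem nrComplexPlaces_eq_zero_of_disc_pos (hirr : Irreducible (MonicCubic.polyQ A B C))
    (hθ : aeval θ (MonicCubic.poly A B C) = 0) (h3 : finrank ℚ K = 3)
    (hpos : 0 < MonicCubic.disc A B C) : nrComplexPlaces K = 0 := by
  have hd : 0 < NumberField.discr K := by
    have hne := indexDet_ne_zero (MonicCubic.pb hirr hθ h3) (MonicCubic.isIntegral_pb_gen hirr hθ h3)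
    have hsq : 0 < indexDet (MonicCubic.pb hirr hθ h3) (MonicCubic.isIntegral_pb_gen hirr hθ h3) ^ 2 :=
      by positivity
    rw [disc_eq_indexDet_sq_mul_discr hirr hθ h3] at hpos
    exact pos_of_mul_pos_right hpos hsq.le
  have hs := NumberField.sign_discr (K := K)
  rw [Int.sign_eq_one_of_pos hd] at hs
  have heven : Even (nrComplexPlaces K) := by
    by_contra hodd
    rw [Nat.not_even_iff_odd] at hodd
    rw [hodd.neg_one_pow] at hs
    norm_num at hs
  have hle := nrComplexPlaces_le_one h3
  obtain ⟨k, hk⟩ := heven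
  omega

/-- **Totally real cubic: unit rank two**. [cite: Marcus2018, Ch. 5] -/
theorem units_rank_eq_two_of_disc_pos (hirr : Irreducible (MonicCubic.polyQ A B C))
    (hθ : aeval θ (MonicCubic.poly A B C) = 0) (h3 : finrank ℚ K = 3)
    (hpos : 0 < MonicCubic.disc A B C) : NumberField.Units.rank K = 2 := by
  have h := card_add_two_mul_card_eq_rank K
  have hc := nrComplexPlaces_eq_zero_of_disc_pos hirr hθ h3 hpos
  rw [hc, h3] at h
  rw [NumberField.Units.rank, card_eq_nrRealPlaces_add_nrComplexPlaces, hc]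
  omega

/-! ## Class number one from a Minkowski bound `< 2` -/

/-- **`h_K = 1` for cubic fields with `|Δ(F)| ≤ 49`**: the Minkowski bound
`(4/π)^{r₂}·(3!/3³)·√|d_K| ≤ (4/π)·(6/27)·7 < 2`. [cite: Marcus2018, Ch. 5, Cor. 2 of Thm 37] -/
theorem isPrincipalIdealRing_of_abs_disc_le (hirr : Irreducible (MonicCubic.polyQ A B C))
    (hθ : aeval θ (MonicCubic.poly A B C) = 0) (h3 : finrank ℚ K = 3)
    (h : |MonicCubic.disc A B C| ≤ 49) : IsPrincipalIdealRing (𝓞 K) := by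
  apply RingOfIntegers.isPrincipalIdealRing_of_abs_discr_lt
  have hle := abs_discr_le_abs_disc hirr hθ h3
  have hd : ((|NumberField.discr K| : ℤ) : ℝ) ≤ 49 := by exact_mod_cast hle.trans h
  have hc := nrComplexPlaces_le_one h3
  have hpi := Real.pi_gt_d2
  have hpi4 : π / 4 ≤ 1 := by linarith [Real.pi_le_four]
  have hpow : π / 4 ≤ (π / 4) ^ nrComplexPlaces K := by
    interval_cases (nrComplexPlaces K) <;> simp [hpi4]
  rw [h3]
  have h27 : ((3 : ℕ) : ℝ) ^ (3 : ℕ) / ((Nat.factorial 3 : ℕ) : ℝ) = 9 / 2 := by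
    norm_num [Nat.factorial]
  rw [h27]
  have hlow : (49 : ℝ) < (2 * (π / 4) * (9 / 2)) ^ 2 := by nlinarith
  calc ((|NumberField.discr K| : ℤ) : ℝ) ≤ 49 := hd
    _ < (2 * (π / 4) * (9 / 2)) ^ 2 := hlow
    _ ≤ (2 * (π / 4) ^ nrComplexPlaces K * (9 / 2)) ^ 2 := by
        gcongr

/-- **`h_K = 1` for totally real cubic fields with `Δ(F) ≤ 80`** (`r₂ = 0`: Minkowski bound
`(6/27)·√80 < 2`). [cite: Marcus2018, Ch. 5, Cor. 2 of Thm 37] -/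
theorem isPrincipalIdealRing_of_disc_pos_le (hirr : Irreducible (MonicCubic.polyQ A B C))
    (hθ : aeval θ (MonicCubic.poly A B C) = 0) (h3 : finrank ℚ K = 3)
    (hpos : 0 < MonicCubic.disc A B C) (h : MonicCubic.disc A B C ≤ 80) :
    IsPrincipalIdealRing (𝓞 K) := by
  apply RingOfIntegers.isPrincipalIdealRing_of_abs_discr_lt
  have hle := abs_discr_le_abs_disc hirr hθ h3
  rw [abs_of_pos hpos] at hle
  have hd : (|NumberField.discr K| : ℝ) ≤ 80 := by exact_mod_cast hle.trans h
  rw [nrComplexPlaces_eq_zero_of_disc_pos hirr hθ h3 hpos, h3]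
  have h27 : ((3 : ℕ) : ℝ) ^ (3 : ℕ) / ((Nat.factorial 3 : ℕ) : ℝ) = 9 / 2 := by
    norm_num [Nat.factorial]
  rw [h27]
  norm_num
  linarith

end Signature

/-! ## The concrete model `ℚ[X]/(F)` -/

section Model

variable (A B C : ℤ) [Fact (Irreducible (MonicCubic.polyQ A B C))]

/-- **The cubic field `ℚ(θ) = ℚ[X]/(F)`**, `F = X³ + AX² + BX + C` irreducible. [folklore] -/
abbrev CubicField : Type := AdjoinRoot (MonicCubic.polyQ A B C)

namespace CubicField

/-- The root `θ = X mod F`. [folklore] -/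
def root : CubicField A B C := AdjoinRoot.root (MonicCubic.polyQ A B C)

/-- `F(θ) = 0` (integer-coefficient form). [folklore] -/
theorem aeval_root : aeval (root A B C) (MonicCubic.poly A B C) = 0 := by
  -- via `eval₂`, so that no particular `Algebra ℤ/ℚ (AdjoinRoot _)` instance is singled out
  have hφ : (algebraMap ℤ (CubicField A B C)) =
      (AdjoinRoot.of (MonicCubic.polyQ A B C)).comp (algebraMap ℤ ℚ) := RingHom.ext_int _ _
  rw [aeval_def, hφ, ← eval₂_map]
  exact AdjoinRoot.eval₂_root (MonicCubic.polyQ A B C)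

/-- `[ℚ(θ) : ℚ] = 3`. [folklore] -/
theorem finrank_eq : finrank ℚ (CubicField A B C) = 3 := by
  rw [PowerBasis.finrank (AdjoinRoot.powerBasis (MonicCubic.monic_polyQ A B C).ne_zero),
    AdjoinRoot.powerBasis_dim, MonicCubic.natDegree_polyQ]

end CubicField

end Model

end Summit.BirchSwinnertonDyer.BirchSwinnertonDyer.Rank2Observatory.TwoDescCubic

end
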